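import Summits.BirchSwinnertonDyer.BirchSwinnertonDyer.Theorems.KolyvaginDepthDoorDepthTableRankTwo707a1TwistBSDQuotient
import Summits.BirchSwinnertonDyer.BirchSwinnertonDyer.Theorems.KolyvaginDepthDoorDepthTableSteinWuthrichEvenRankBSDQuotientExact
import HarnessLib

/-!
# Route `KolyvaginDepthDoor`, crux `KolyvaginDepthSupplyKN` (stmt-BirchSwinnertonDyer-22820) —
# DEPTH TABLE v15, EXACT ROW `707a1` at `(p, d_K) = (5, -19)`: ONE KOLYVAGIN BIT ⟺ THE BSD QUOTIENT OF THE HEEGNER TWIST IS A `5`-ADIC UNIT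

Helper file of the lead prover of line `levelone` (kdd-p1 g19; `--supports stmt-BirchSwinnertonDyer-22820
--as helper`); it closes nothing and BSD is NOT proved by it.

The v13 row `C707a1.exactRow_5_neg19_twistSelmer` (g17) is the biconditional «∃ frame, Kolyvagin prime `ℓ`, datum with `c_1(ℓ) ≠ 0`» ⟺
«`#Sel_5(E^{(d_K)}/ℚ) ≤ 5`», for every imaginary quadratic `K` with `d_K = -19`. `KolyvaginDepthDoorDepthTableRankTwo707a1TwistBSDQuotient` (g19) supplies a
kernel-certified minimal model `T₀ = [0, -1, 1, -4452, -110483]` of the twist with `ρ̄_{T,5}` onto, good ordinary `5`, Kodaira–Néron, non-CM, and the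
`ℚ`-isomorphism `minTwist19_smul_eq`; the generic `natCard_selmerGroup_le_iff_bsdQuotient_unit_bcs` (Burungale–Castella–Skinner 2025 Cor. 1.3.1 +
GZK by name) turns «`#Sel_5(T) ≤ 5`» into «`L'(T,1)/(Ω_T·Reg_T)` is a `5`-adic unit» when `ord_{s=1} L(T,s) = 1`. Composing:

* `exactRow_5_neg19_bsdQuotientUnit` — for every `K` with `d_K = -19`, GIVEN `ord_{s=1} L(T₀,s) = 1`:
  «one Kolyvagin bit at `(707a1, 5, K)`» ⟺ «`∃ q ∈ ℚ, L'(T₀,1)/(Ω_{T₀}·Reg_{T₀}) = q ∧ ord_5 q = 0`».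

So a Jetchev–Lauter–Stein computation of the bit DECIDES the `5`-adic unit-ness of `#Ш_an(T)·Tam(T)` for the rank-one twist, and the
observatory's numerics (`CERT-TABLE.md`: `#Ш_an(T) = 1`, `5 ∤ c(T)`) PREDICT the bit `= 1` — the cyclotomic / anticyclotomic agreement
instrument of the route at this curve, in exact form. CONDITIONAL on the named print facts; per curve; nothing class-wide (the open stub (S♭) is
untouched); BSD is NOT proved by it.

References: [BurungaleCastellaSkinner2025] Cor. 1.3.1 (p. 4); [Darmon2004] Thm. 3.22; [SteinWuthrich2013] Thm. 1.1; [WZhang2014] L8.4 (1),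
Thm. 9.1; [GrossLMS1991] Prop. 3.7 (2); [arXiv:0707.0032] §3.6 (the instrument); [SilvermanAEC2009] X.4.2.
-/

set_option linter.dupNamespace false

noncomputable section

open scoped Classical NumberField

namespace Summit.BirchSwinnertonDyer.BirchSwinnertonDyer.Theorems.KolyvaginDepthDoor

open Literature.NumberTheory.EllipticCurves Literature.NumberTheory.EllipticCurves.ModularForms
  WeierstrassCurve NumberField IsDedekindDomain
open Summit.BirchSwinnertonDyer.BirchSwinnertonDyer.Theorems
open Summit.BirchSwinnertonDyer.BirchSwinnertonDyer.Rank2Observatory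
open Summit.BirchSwinnertonDyer.BirchSwinnertonDyer.Rank1Residual
open Summit.BirchSwinnertonDyer.Rank1Residual.Additive

namespace C707a1

/-- **EXACT DEPTH-TABLE ROW `707a1` AT `(p, d_K) = (5, -19)`, BSD-QUOTIENT CURRENCY.** For `E = 707a1`, ANY imaginary quadratic `K` with
`d_K = -19`, and the minimal model `T₀ = [0, -1, 1, -4452, -110483]` of the Heegner twist `E^{(-19)}`, GRANTED `ord_{s=1} L(T₀, s) = 1`:
«some frame, some Kolyvagin prime `ℓ`, some datum of conductor `ℓ` with `c_1(ℓ) ≠ 0`» ⟺ «`∃ q ∈ ℚ`, `L'(T₀,1)/(Ω_{T₀}·Reg_{T₀}) = q` and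
`ord_5 q = 0`» — the computed bit IS the `5`-adic unit-ness of the BSD quotient `#Ш_an·Tam` of ONE rank-one curve. From the v13 row
`exactRow_5_neg19_twistSelmer` (bit ⟺ `#Sel_5(E^{(d_K)}) ≤ 5`), transport along `minTwist19_smul_eq`, and `natCard_selmerGroup_le_iff_bsdQuotient_unit_bcs` at
the certificates of `T₀`. CONDITIONAL on the named print facts and `r_an(T₀) = 1`; per curve; BSD is not proved by it.
[cite: BurungaleCastellaSkinner2025, Cor. 1.3.1 (p. 4)] [cite: Darmon2004, Thm. 3.22] [cite: SteinWuthrich2013, Thm. 1.1 (p. 1758)] [cite: CastellaSano2026, Thm. 3] [cite: GrossLMS1991, Prop. 3.7 (2)] [cite: SilvermanAEC2009, Thm. X.4.2] -/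
theorem exactRow_5_neg19_bsdQuotientUnit
    (hSW : SteinWuthrich2013_sha_inf_torsionBy_eq_bot_of_two_le_rank)
    (h372 : GrossLMS1991.prop37_2_frobeniusCongruence)
    (h3 : Literature.NumberTheory.EllipticCurves.CastellaSano2026_kolyvaginClass_selmerDivisibility_eq_padicValNat_tamagawaProduct)
    (hZ : Literature.NumberTheory.EllipticCurves.Zanarella2019_kolyvaginClass_one_ne_zero_of_not_selmerDivisible)
    (hHZ : Literature.NumberTheory.EllipticCurves.HowardZanarella_exists_minimal_kolyvaginClass_one_selmerCard_of_ne_zero)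
    (hnf : exists_isNewformOf)
    (hMaz : mazur_not_dvd_maninConstant_of_odd)
    (hBCS : BurungaleCastellaSkinner2025.cor131_padicValRat_bsd_rank_le_one)
    (hGZK : rank_eq_analyticRank_of_analyticRank_le_one)
    (K : Type) [Field K] [NumberField K] (hK : IsImaginaryQuadratic K) (hD : NumberField.discr K = -19)
    (hr : haveI := minTwist19_isElliptic;
      ((⟨0, -1, 1, -4452, -110483⟩ : WeierstrassCurve ℤ).map (Int.castRingHom ℚ)).analyticRank = 1) :
    haveI := isElliptic_c707a1;
    haveI := isGloballyMinimal_c707a1;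
    haveI : NeZero (((⟨0, 1, 1, -12, 12⟩ : WeierstrassCurve ℤ).map (Int.castRingHom ℚ)).conductorNorm ℤ) := neZero_conductorNorm_of_isElliptic _;
    haveI := Fact.mk (by norm_num : Nat.Prime 5);
    (∃ (Dt : ModularParametrizationData ((⟨0, 1, 1, -12, 12⟩ : WeierstrassCurve ℤ).map (Int.castRingHom ℚ)) (((⟨0, 1, 1, -12, 12⟩ : WeierstrassCurve ℤ).map (Int.castRingHom ℚ)).conductorNorm ℤ)) (β : ℤ)
      (ι : K →+* ℂ) (ℓ : ℕ) (d : KolyvaginHeegnerData Dt β ι ℓ),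
      ℓ.Prime ∧ Zhang2014.IsKolyvaginPrime (((⟨0, 1, 1, -12, 12⟩ : WeierstrassCurve ℤ).map (Int.castRingHom ℚ)).conductorNorm ℤ) ((⟨0, 1, 1, -12, 12⟩ : WeierstrassCurve ℤ).map (Int.castRingHom ℚ)) K 5 ℓ ∧
        d.kolyvaginClass (p := 5) (by norm_num) 1 ≠ 0) ↔
    (haveI := minTwist19_isElliptic; haveI := minTwist19_isGloballyMinimal;
      ∃ q : ℚ, ((⟨0, -1, 1, -4452, -110483⟩ : WeierstrassCurve ℤ).map (Int.castRingHom ℚ)).leadingLCoeff /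
          (((((⟨0, -1, 1, -4452, -110483⟩ : WeierstrassCurve ℤ).map (Int.castRingHom ℚ)).realPeriodRat *
              ((⟨0, -1, 1, -4452, -110483⟩ : WeierstrassCurve ℤ).map (Int.castRingHom ℚ)).regulator : ℝ)) : ℂ) = (q : ℂ) ∧
        padicValRat 5 q = 0) := by
  haveI := isElliptic_c707a1
  haveI := isGloballyMinimal_c707a1
  haveI : NeZero (((⟨0, 1, 1, -12, 12⟩ : WeierstrassCurve ℤ).map (Int.castRingHom ℚ)).conductorNorm ℤ) := neZero_conductorNorm_of_isElliptic _
  haveI := Fact.mk (by norm_num : Nat.Prime 5)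
  refine (exactRow_5_neg19_twistSelmer hSW h372 h3 hZ hHZ hnf hMaz K hK hD).trans ?_
  have hcast : (NumberField.discr K : ℚ) = ((-19) : ℚ) := by rw [hD]; norm_num
  rw [hcast, ← natCard_selmerGroup_eq_of_variableChange (((5 : ℕ) : ℤ)) minTwist19_smul_eq]
  haveI := minTwist19_isElliptic
  haveI := minTwist19_isGloballyMinimal
  exact natCard_selmerGroup_le_iff_bsdQuotient_unit_bcs hBCS hGZK _ 5 (by norm_num) minTwist19_not_hasCM
    minTwist19_goodOrdinary_5.1 minTwist19_goodOrdinary_5.2 minTwist19_hasSurjectiveModNGaloisRep_5 minTwist19_kodairaNeron_5 hr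

end C707a1

end Summit.BirchSwinnertonDyer.BirchSwinnertonDyer.Theorems.KolyvaginDepthDoor

end
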